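import Summits.AtomisticToContinuum.Crystallization.Theorems.FrustratedLawDichotomyStrainedPatchHomCurvLeafL

/-!
# KERNEL TEST of the centred curvature leaf: the production label split at hcp⋆, box `U ± 2⁻⁹ × ξ ± 0.005`, floor `λ = 4`

decomp-a2c hand-1 g27 (crux `AperiodicFrustratedLawGap`, stmt-AtomisticToContinuum-27623; `(H) HomFloor (1/625)`, hcp half; lever (C), critic rows
1040 (b) / 1044: «report certified λ on (U 2⁻⁹ × ξ …)»).  Box centre `U = diag(0.97128, 0.97128, 0.9711)`, `ξ = 0`; half-widths `2⁻⁹` on the nine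
entries and `0.005` on the shuffle; centred labels = the `B`-labels with `labelOK` and `ρ₀ < 2` (24: shells `0.97 / 1.37 / 1.68`), naive labels = the
other `B`-labels within `4.7` (336), both selected IN THE KERNEL from `…HomCurvLeaf.nearLabels`.  `curvCheckL` passes at `λ = 4` (compiled
evaluation of the same definitions: sign-vertex floor of the matrix part `8.42`, with the first-order bound `7.38`, remainder `2.98`, certified `4.39`;
`λ_min` of the centre Hessian `8.53`).  For comparison `…HomCurvLeaf.curvCheck2` certifies `λ = 2` only at half-width `2⁻¹¹` on all twelve
coordinates and nothing at `2⁻⁹`.  Kernel time ≈ 35 s.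

Test data definitions + one kernel theorem; 0 sorry; standard axioms; no instances / notation / `#eval`.  `--supports stmt-AtomisticToContinuum-27623`.
-/

namespace Summit.AtomisticToContinuum.Crystallization.Theorems.FrustratedLawDichotomyStrainedPatchHomCurvLeafL

open Literature.Analysis.ValidatedNumerics.Numerics
open Summit.AtomisticToContinuum.Crystallization.Theorems.FrustratedLawDichotomyStrainedPatchHomCurvLeaf (nearLabels)
open Summit.AtomisticToContinuum.Crystallization.Theorems.FrustratedLawDichotomyStrainedPatchHomCurvCentreKit (rho0)

/-- Box centre at hcp⋆: `U = diag(0.97128, 0.97128, 0.9711)` (scaled), `ξ = 0`. -/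
def cStarL : (Fin 3 × Fin 3) ⊕ Fin 3 → ℤ :=
  Sum.elim (fun ab => if ab.1 = ab.2 then (if ab.1 = 2 then 273340349883718 else 273391015379526) else 0) (fun _ => 0)

/-- Half-widths `2⁻⁹` (entries) and `0.005` (shuffle), scaled. -/
def wStarL : (Fin 3 × Fin 3) ⊕ Fin 3 → ℤ := Sum.elim (fun _ => 549755813888) (fun _ => 1407374883553)

/-- Centred-label selector: `labelOK` and centre radius `< 2`. -/
def isCenL (c w : (Fin 3 × Fin 3) ⊕ Fin 3 → ℤ) (b : Fin 3 → ℤ) : Bool := labelOK c w b && decide ((rho0 c b).hi < 2 * (SC : ℤ))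

/-- The centred labels of the test box (computed in the kernel). -/
def LcStar : List (Fin 3 → ℤ) := (nearLabels cStarL wStarL 2209 100).filter fun b => isCenL cStarL wStarL b

/-- The naive labels of the test box (computed in the kernel). -/
def LnStar : List (Fin 3 → ℤ) := (nearLabels cStarL wStarL 2209 100).filter fun b => !(isCenL cStarL wStarL b)

/-- ★ KERNEL TEST: the centred leaf certifies the curvature floor `λ = 4` on the hcp⋆ box `U ± 2⁻⁹ × ξ ± 0.005` with the production label split. -/
theorem curvCheckL_star : curvCheckL cStarL wStarL LcStar LnStar (4 * 281474976710656) = true := by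
  decide +kernel

end Summit.AtomisticToContinuum.Crystallization.Theorems.FrustratedLawDichotomyStrainedPatchHomCurvLeafL
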